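import Summits.QuantumFields.BalabanUV.Gaps.EndDrawdownLinearThresholdConstant
import Summits.QuantumFields.BalabanUV.Gaps.EndDrawdownLinearThresholdRenormSuff

/-!
# Gaps / EndDrawdownLinearThresholdLower — HALF OF THE CONJECTURE IN THE KERNEL: `C⋆(bOct) ≥ √(84∕(77 + 72·log 2)) = 0.81357…`

GEN 11 left the octal threshold of the linear (AF-1) road at the KERNEL bracket `4∕5 ≤ C⋆(bOct) ≤ 9∕10`
(`EndDrawdownLinearThresholdRenormSuff.exists_threshold_bOct_decimal`), at the exact-rational certified bracket `[0.81, 0.816]`, and at the CONJECTURE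
`C⋆ = cStarConj := √(84∕(77 + 72·log 2))` (reading note `g1/THRESHOLD-READING-P3.md` §4).  X16 (`EndDrawdownLinearThresholdConstant`) proved the
calculus behind the constant; THIS FILE proves the LOWER HALF OF THE IDENTIFICATION:
**`not_endPossibleLin_bOct_of_lt_cStarConj`: for every `0 < C < cStarConj` and every box `γ₀ > 0`, `¬ EndPossibleLin bOct C γ₀`** — hence
**`exists_threshold_bOct_conjLower`: `cStarConj ≤ C⋆(bOct) ≤ 9∕10`** (kernel lower bound `0.8 → 0.81357…`, past the certified `0.81`; the numeric
instance **`not_endPossibleLin_bOct_081357`**).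
MECHANISM (no limits, no Gronwall, no differentiability of any flow): feed GEN 11's `8^m`-piece NECESSITY CRITERION
`EndDrawdownLinearThresholdRenormFine.not_endPossibleLin_bOct_of_prefixed` (`∃ σ ≥ C², σ ≤ S_m C σ ⟹ impossible`) the point `σ₀ = (7C∕6)²`
(half the tangency height) and compare the explicit Euler pieces with X16's flow-time function `T_C`: because the speed `1 − C∕√w` INCREASES
along the forward motion, ONE EULER PIECE OF NOMINAL TIME `h` COSTS FLOW TIME AT LEAST `h − (C∕(2v₀³))·h²` from any point `x ≥ v₀²`
(**`flowTime_eStep_ge`**, from the monotone comparison **`flowTime_sub_ge`**: `T(b) − T(a) ≥ (b² − a²)·b∕(b − C)`); so the `8^m` pieces of one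
block started at `σ₀` cost flow time `≥ 7 − 49λ∕8^m`, `λ = C∕(2v₀³)` (**`flowTime_iterate_ge`**); but doubling `v` from `v₀ = 7C∕6` costs EXACTLY
`T(7C∕3) − T(7C∕6) = C²·ψ(7∕3)` (X16 `flowTime_halving_at_tangency`), which is `< 7` precisely when `C < cStarConj`; choosing `8^m > 49λ∕(7 − C²ψ(7∕3))`
the Euler block from `σ₀` at least QUADRUPLES the height, i.e. `σ₀ ≤ S_m C σ₀` (**`exists_prefixed_of_lt_cStarConj`**), and the criterion fires.
§1b records the mirror tools for the UPPER half (X19 `EndDrawdownLinearThresholdUpper`): **`flowTime_sub_le`** (`T(b) − T(a) ≤ (b² − a²)·a∕(a − C)`),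
**`sq_lt_rStep`** ∕ **`flowTime_rStep_bounds`** ∕ **`flowTime_iterate_rStep`** (one BACKWARD Euler piece `rStep C h x = x − h(1 − C∕√x)` of GEN 11's
sufficiency data stays above the floor and costs flow time in `[h, 2C²h∕(2C² − h)]`, `0 ≤ h < 2C²`).  The upper half itself — NOT here.

WHAT IS NOT CLAIMED: the value of `C⋆(bOct)` (only `cStarConj ≤ C⋆ ≤ 9∕10`); anything about Bałaban's table.  (cell pub-balaban-gaps, seat g1-p3
GEN 12, rows CAP ∕ tail «split ∕ weakening»; own leaf; file 34 of «the one-loop interface of the END statement»; imports X16 + X15.)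

HONEST FRAMING (cell rule, page 1 of everything): [folklore] one-variable calculus (a monotone comparison between an explicit Euler scheme and the
time function of a scalar ODE) fed to the seat's kernel-checked necessity criterion for ONE toy sequence; `EndPossibleLin` is a quantified READING
of the cell's END-grade statement over Bałaban-free data `(b, C, γ₀)`; 0 binders of Bałaban's discharged; 0 coefficients certified; words ∕ odds of
rows CAP ∕ tail ∕ (D4) ∕ (D1) UNCHANGED; one finite T⁴; NOT [I] Thm 2, NOT `BetaPertH`, NOT the continuum limit, NOT Clay.
-/

namespace Summit.QuantumFields.BalabanUV.Gaps.EndDrawdownLinearThresholdLower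

open Real Set
open Summit.QuantumFields.BalabanUV.Gaps.EndDrawdownLinearRoad (EndPossibleLin)
open Summit.QuantumFields.BalabanUV.Gaps.EndDrawdownCooperatorExtremal (endPossibleLin_mono)
open Summit.QuantumFields.BalabanUV.Gaps.EndDrawdownLinearThreshold (bOct)
open Summit.QuantumFields.BalabanUV.Gaps.EndDrawdownLinearThresholdRenormFine (tau eStep S tau_pos le_iterate_eStep
  not_endPossibleLin_bOct_of_prefixed)
open Summit.QuantumFields.BalabanUV.Gaps.EndDrawdownLinearThresholdRenormPieces (rStep)
open Summit.QuantumFields.BalabanUV.Gaps.EndDrawdownLinearThresholdRenormSuff (endPossibleLin_bOct_090)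
open Summit.QuantumFields.BalabanUV.Gaps.EndDrawdownLinearThresholdConstant

noncomputable section

/-! ## §0 `T_C` is strictly increasing on `(C, ∞)` -/

/-- `T_C` is strictly increasing on `(C, ∞)` (`T_C′(v) = 2v²∕(v − C) > 0`). [folklore] -/
theorem flowTime_strictMonoOn {C : ℝ} (hC : 0 < C) : StrictMonoOn (flowTime C) (Ioi C) := by
  refine strictMonoOn_of_deriv_pos (convex_Ioi C)
    (fun v hv => (hasDerivAt_flowTime (mem_Ioi.mp hv)).continuousAt.continuousWithinAt) fun v hv => ?_
  rw [interior_Ioi] at hv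
  have hv' : C < v := hv
  have h0 : 0 < v := lt_trans hC hv'
  rw [(hasDerivAt_flowTime hv').deriv]
  exact div_pos (by positivity) (sub_pos.mpr hv')

/-- `T_C` is injective on `(C, ∞)`. [folklore] -/
theorem flowTime_injOn {C : ℝ} (hC : 0 < C) : InjOn (flowTime C) (Ioi C) :=
  (flowTime_strictMonoOn hC).injOn

/-! ## §1 The monotone comparison: one Euler piece costs almost its nominal time -/

/-- MONOTONE COMPARISON: for `C < a ≤ b` (`0 < C`), `T_C(b) − T_C(a) ≥ (b² − a²)·b∕(b − C)` — the function `u ↦ T_C(u) − u²·b∕(b − C)` is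
non-decreasing on `[a, b]` because `T_C′(u) = 2u·u∕(u − C)` and `u∕(u − C) ≥ b∕(b − C)` there. [folklore] -/
theorem flowTime_sub_ge {C a b : ℝ} (hC : 0 < C) (ha : C < a) (hab : a ≤ b) :
    (b ^ 2 - a ^ 2) * (b / (b - C)) ≤ flowTime C b - flowTime C a := by
  have hbC : 0 < b - C := by linarith
  set k := b / (b - C) with hk
  have hD : ∀ u ∈ Icc a b, HasDerivAt (fun u : ℝ => flowTime C u - u ^ 2 * k) (2 * u ^ 2 / (u - C) - 2 * u * k) u := by
    intro u hu
    have huC : C < u := lt_of_lt_of_le ha hu.1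
    have h2 : HasDerivAt (fun u : ℝ => u ^ 2 * k) (2 * u * k) u := by
      simpa using (hasDerivAt_pow 2 u).mul_const k
    exact (hasDerivAt_flowTime huC).sub h2
  have hmono : MonotoneOn (fun u : ℝ => flowTime C u - u ^ 2 * k) (Icc a b) := by
    refine monotoneOn_of_hasDerivWithinAt_nonneg (convex_Icc a b) (fun u hu => (hD u hu).continuousAt.continuousWithinAt)
      (fun u hu => (hD u (interior_subset hu)).hasDerivWithinAt) fun u hu => ?_
    rw [interior_Icc] at hu
    have huC : 0 < u - C := by linarith [hu.1]
    have hu0 : 0 < u := by linarith [hu.1]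
    -- 2u²∕(u−C) − 2u·b∕(b−C) = 2uC(b − u)∕((u−C)(b−C)) ≥ 0
    have hid : 2 * u ^ 2 / (u - C) - 2 * u * k = 2 * u * C * (b - u) / ((u - C) * (b - C)) := by
      rw [hk]
      field_simp
      ring
    rw [hid]
    have : 0 ≤ b - u := by linarith [hu.2]
    positivity
  have h := hmono ⟨le_rfl, hab⟩ ⟨hab, le_rfl⟩ hab
  simp only at h
  linarith

/-- ONE EXPLICIT EULER PIECE COSTS ALMOST ITS NOMINAL TIME: for `0 < C < v₀`, `h ≥ 0` and `x ≥ v₀²`, the flow time from `√x` to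
`√(eStep C h x)` (`eStep C h x = x + h(1 − C∕√x)`, GEN 11's forward Euler piece) is at least `h − (C∕(2v₀³))·h²`. [folklore] -/
theorem flowTime_eStep_ge {C v₀ h x : ℝ} (hC : 0 < C) (hv₀ : C < v₀) (hh : 0 ≤ h) (hx : v₀ ^ 2 ≤ x) :
    h - C / (2 * v₀ ^ 3) * h ^ 2 ≤ flowTime C (Real.sqrt (eStep C h x)) - flowTime C (Real.sqrt x) := by
  have hv₀0 : 0 < v₀ := lt_trans hC hv₀
  have hx0 : 0 < x := lt_of_lt_of_le (by positivity) hx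
  set a := Real.sqrt x with ha
  have ha0 : 0 < a := Real.sqrt_pos.mpr hx0
  have hav : v₀ ≤ a := (Real.le_sqrt' hv₀0).mpr hx
  have haC : C < a := lt_of_lt_of_le hv₀ hav
  have hax : a ^ 2 = x := Real.sq_sqrt hx0.le
  have hg : 0 ≤ h * (1 - C / a) := mul_nonneg hh (by rw [sub_nonneg, div_le_one ha0]; exact haC.le)
  have hy : eStep C h x = a ^ 2 + h * (1 - C / a) := by simp only [eStep, ← ha, hax]
  have hy0 : 0 ≤ a ^ 2 + h * (1 - C / a) := by positivity
  set b := Real.sqrt (eStep C h x) with hb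
  have hb2 : b ^ 2 = a ^ 2 + h * (1 - C / a) := by rw [hb, hy, Real.sq_sqrt hy0]
  have hxy : x ≤ eStep C h x := by rw [hy, ← hax]; linarith
  have hab : a ≤ b := by rw [ha, hb]; exact Real.sqrt_le_sqrt hxy
  have hbC : 0 < b - C := by linarith
  have h1 := flowTime_sub_ge hC haC hab
  -- the relation between the Euler increment and `b − a`
  have hrel : a * ((b - a) * (b + a)) = h * (a - C) := by
    have e : a * ((b - a) * (b + a)) = a * (b ^ 2 - a ^ 2) := by ring
    rw [e, hb2]
    field_simp
    ring
  -- `2a²(b − a) ≤ h(b − C)`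
  have hBA : 2 * a ^ 2 * (b - a) ≤ h * (b - C) := by
    have hba0 : 0 ≤ b - a := sub_nonneg.mpr hab
    have h3 : 2 * a ^ 2 * (b - a) ≤ a * ((b - a) * (b + a)) := by
      nlinarith [mul_nonneg ha0.le (mul_nonneg hba0 hba0)]
    have h4 : h * (a - C) ≤ h * (b - C) := mul_le_mul_of_nonneg_left (by linarith) hh
    linarith [hrel]
  -- the deficit `h − (b² − a²)·b∕(b−C) = hC(b − a)∕(a(b − C)) ≤ C h²∕(2a³) ≤ C h²∕(2v₀³)`
  have hdef : h - (b ^ 2 - a ^ 2) * (b / (b - C)) = h * C * (b - a) / (a * (b - C)) := by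
    rw [hb2]
    field_simp
    ring
  have hstep2 : h * C * (b - a) / (a * (b - C)) ≤ C * h ^ 2 / (2 * a ^ 3) := by
    rw [div_le_div_iff₀ (by positivity) (by positivity)]
    have := mul_le_mul_of_nonneg_left hBA (show 0 ≤ C * a * h by positivity)
    nlinarith [this]
  have hstep3 : C * h ^ 2 / (2 * a ^ 3) ≤ C / (2 * v₀ ^ 3) * h ^ 2 := by
    rw [div_mul_eq_mul_div]
    apply div_le_div_of_nonneg_left (by positivity) (by positivity)
    gcongr
  linarith

/-- `k` EULER PIECES from `v₀²` cost flow time at least `k·(h − (C∕(2v₀³))·h²)` (the trajectory never drops below its start —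
`EndDrawdownLinearThresholdRenormFine.le_iterate_eStep`). [folklore] -/
theorem flowTime_iterate_ge {C v₀ h : ℝ} (hC : 0 < C) (hv₀ : C < v₀) (hh : 0 ≤ h) (k : ℕ) :
    (k : ℝ) * (h - C / (2 * v₀ ^ 3) * h ^ 2) ≤
      flowTime C (Real.sqrt ((eStep C h)^[k] (v₀ ^ 2))) - flowTime C (Real.sqrt (v₀ ^ 2)) := by
  have hCv : C ^ 2 ≤ v₀ ^ 2 := pow_le_pow_left₀ hC.le hv₀.le 2
  induction k with
  | zero => simp
  | succ k ih =>
    rw [Function.iterate_succ_apply', Nat.cast_succ]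
    have hxk : v₀ ^ 2 ≤ (eStep C h)^[k] (v₀ ^ 2) := le_iterate_eStep hC hh hCv k
    have := flowTime_eStep_ge hC hv₀ hh hxk
    linarith

/-! ## §1b The mirror comparison and the BACKWARD Euler piece (used by X19 for the upper half) -/

/-- UPPER COMPARISON: for `C < a ≤ b` (`0 < C`), `T_C(b) − T_C(a) ≤ (b² − a²)·a∕(a − C)` (`u∕(u − C) ≤ a∕(a − C)` on `[a, b]`). [folklore] -/
theorem flowTime_sub_le {C a b : ℝ} (hC : 0 < C) (ha : C < a) (hab : a ≤ b) :
    flowTime C b - flowTime C a ≤ (b ^ 2 - a ^ 2) * (a / (a - C)) := by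
  have haC : 0 < a - C := by linarith
  set k := a / (a - C) with hk
  have hD : ∀ u ∈ Icc a b, HasDerivAt (fun u : ℝ => flowTime C u - u ^ 2 * k) (2 * u ^ 2 / (u - C) - 2 * u * k) u := by
    intro u hu
    have huC : C < u := lt_of_lt_of_le ha hu.1
    have h2 : HasDerivAt (fun u : ℝ => u ^ 2 * k) (2 * u * k) u := by
      simpa using (hasDerivAt_pow 2 u).mul_const k
    exact (hasDerivAt_flowTime huC).sub h2
  have hanti : AntitoneOn (fun u : ℝ => flowTime C u - u ^ 2 * k) (Icc a b) := by
    refine antitoneOn_of_hasDerivWithinAt_nonpos (convex_Icc a b) (fun u hu => (hD u hu).continuousAt.continuousWithinAt)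
      (fun u hu => (hD u (interior_subset hu)).hasDerivWithinAt) fun u hu => ?_
    rw [interior_Icc] at hu
    have huC : 0 < u - C := by linarith [hu.1]
    have hu0 : 0 < u := by linarith [hu.1]
    have hid : 2 * u ^ 2 / (u - C) - 2 * u * k = -(2 * u * C * (u - a) / ((u - C) * (a - C))) := by
      rw [hk]
      field_simp
      ring
    rw [hid, neg_nonpos]
    have : 0 ≤ u - a := by linarith [hu.1]
    positivity
  have h := hanti ⟨le_rfl, hab⟩ ⟨hab, le_rfl⟩ hab
  simp only at h
  linarith

/-- A backward Euler piece from above the floor stays STRICTLY above the floor (`h ≤ 2C²`; any sign of `h`). [folklore] -/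
theorem sq_lt_rStep {C h x : ℝ} (hC : 0 < C) (hh2 : h ≤ 2 * C ^ 2) (hx : C ^ 2 < x) : C ^ 2 < rStep C h x := by
  have hx0 : 0 < x := lt_trans (by positivity) hx
  set b := Real.sqrt x with hb
  have hb0 : 0 < b := Real.sqrt_pos.mpr hx0
  have hbC : C < b := (Real.lt_sqrt hC.le).mpr hx
  have hbx : b ^ 2 = x := Real.sq_sqrt hx0.le
  have hr : rStep C h x = b ^ 2 - h * (1 - C / b) := by simp only [rStep, ← hb, hbx]
  rw [hr]
  have h1 : h * (1 - C / b) = h * (b - C) / b := by field_simp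
  rw [h1]
  rw [show C ^ 2 < b ^ 2 - h * (b - C) / b ↔ h * (b - C) / b < b ^ 2 - C ^ 2 by constructor <;> intro h' <;> linarith]
  rw [div_lt_iff₀ hb0]
  have hbC' : 0 < b - C := sub_pos.mpr hbC
  have e1 : h * (b - C) ≤ 2 * C ^ 2 * (b - C) := mul_le_mul_of_nonneg_right hh2 hbC'.le
  have e2 : 2 * C ^ 2 * (b - C) < (b ^ 2 - C ^ 2) * b := by
    have h3 : 2 * C ^ 2 < (b + C) * b := by nlinarith
    nlinarith [mul_lt_mul_of_pos_right h3 hbC']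
  linarith

/-- ONE BACKWARD EULER PIECE costs flow time between `h` and `2C²h∕(2C² − h)` (`0 ≤ h < 2C²`): the descending speed only decreases, but cannot
collapse faster than the approach to the equilibrium allows (`ab(a + b) ≥ 2C³`). [folklore] -/
theorem flowTime_rStep_bounds {C h x : ℝ} (hC : 0 < C) (hh : 0 ≤ h) (hh2 : h < 2 * C ^ 2) (hx : C ^ 2 < x) :
    h ≤ flowTime C (Real.sqrt x) - flowTime C (Real.sqrt (rStep C h x)) ∧
      flowTime C (Real.sqrt x) - flowTime C (Real.sqrt (rStep C h x)) ≤ 2 * C ^ 2 * h / (2 * C ^ 2 - h) := by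
  have hx0 : 0 < x := lt_trans (by positivity) hx
  set b := Real.sqrt x with hb
  have hb0 : 0 < b := Real.sqrt_pos.mpr hx0
  have hbC : C < b := (Real.lt_sqrt hC.le).mpr hx
  have hbx : b ^ 2 = x := Real.sq_sqrt hx0.le
  have hy := sq_lt_rStep hC hh2.le hx
  have hy0 : 0 < rStep C h x := lt_trans (by positivity) hy
  set a := Real.sqrt (rStep C h x) with ha
  have haC : C < a := (Real.lt_sqrt hC.le).mpr hy
  have ha0 : 0 < a := lt_trans hC haC
  have hay : a ^ 2 = rStep C h x := Real.sq_sqrt hy0.le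
  have hdiff : b ^ 2 - a ^ 2 = h * (b - C) / b := by
    rw [hay, hbx]; simp only [rStep, ← hb]; field_simp; ring
  have hab : a ≤ b := by nlinarith [div_nonneg (mul_nonneg hh (sub_pos.mpr hbC).le) hb0.le, hb0, lt_trans hC haC]
  have hbC' : b - C ≠ 0 := (sub_pos.mpr hbC).ne'
  refine ⟨?_, ?_⟩
  · have h1 := flowTime_sub_ge hC haC hab
    have h2 : (b ^ 2 - a ^ 2) * (b / (b - C)) = h := by rw [hdiff]; field_simp
    linarith
  · have h1 := flowTime_sub_le hC haC hab
    -- `(b² − a²)·a∕(a−C) = h(b−C)a∕(b(a−C)) ≤ 2C²h∕(2C² − h)` because `2C³(b − a) ≤ h·a(b − C)` and `ab(a+b) ≥ 2C³`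
    have hrel : b * ((b - a) * (b + a)) = h * (b - C) := by
      have e : b * ((b - a) * (b + a)) = b * (b ^ 2 - a ^ 2) := by ring
      rw [e, hdiff]; field_simp
    have hkey : 2 * C ^ 3 * (b - a) ≤ h * a * (b - C) := by
      have hba : 0 ≤ b - a := sub_nonneg.mpr hab
      have h3 : 2 * C ^ 3 ≤ a * b * (a + b) := by
        nlinarith [mul_pos ha0 hb0, mul_pos (mul_pos ha0 hb0) (add_pos ha0 hb0), mul_pos hC hC]
      nlinarith [mul_le_mul_of_nonneg_right h3 hba]
    have h2 : (b ^ 2 - a ^ 2) * (a / (a - C)) ≤ 2 * C ^ 2 * h / (2 * C ^ 2 - h) := by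
      rw [hdiff, div_mul_div_comm, div_le_div_iff₀ (by nlinarith [sub_pos.mpr haC]) (by linarith)]
      nlinarith [hkey, mul_pos hb0 (sub_pos.mpr haC), hh, hC]
    linarith

/-- Iterated backward pieces from `x₀ > C²`: all stay above the floor and `k·h ≤ T(√x₀) − T(√x_k) ≤ k·2C²h∕(2C² − h)`. [folklore] -/
theorem flowTime_iterate_rStep {C h x : ℝ} (hC : 0 < C) (hh : 0 ≤ h) (hh2 : h < 2 * C ^ 2) (hx : C ^ 2 < x) (k : ℕ) :
    C ^ 2 < (rStep C h)^[k] x ∧ (k : ℝ) * h ≤ flowTime C (Real.sqrt x) - flowTime C (Real.sqrt ((rStep C h)^[k] x)) ∧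
      flowTime C (Real.sqrt x) - flowTime C (Real.sqrt ((rStep C h)^[k] x)) ≤ (k : ℝ) * (2 * C ^ 2 * h / (2 * C ^ 2 - h)) := by
  induction k with
  | zero => exact ⟨by simpa using hx, by simp, by simp⟩
  | succ k ih =>
    obtain ⟨hk, hlo, hhi⟩ := ih
    rw [Function.iterate_succ_apply', Nat.cast_succ]
    have := flowTime_rStep_bounds hC hh hh2 hk
    exact ⟨sq_lt_rStep hC hh2.le hk, by linarith [this.1], by linarith [this.2]⟩

/-! ## §2 The criterion fires below the conjectured constant -/

/-- Below the constant the tangential doubling time is short: `C < cStarConj ⟹ C²·ψ(7∕3) < 7`. [folklore] -/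
theorem sq_mul_psiMin_lt_seven {C : ℝ} (hC : 0 < C) (hlt : C < cStarConj) : C ^ 2 * psi (7 / 3) < 7 := by
  have h1 : C ^ 2 < cStarConj ^ 2 := by gcongr
  nlinarith [cStarConj_sq_mul_psiMin, psi_seven_thirds_gt_ten]

/-- THE PRE-FIXED POINT: for `0 < C < cStarConj` some `8^m`-piece Euler block started at `σ₀ = (7C∕6)²` at least quadruples the height,
`σ₀ ≤ S_m C σ₀` — the hypothesis of GEN 11's necessity criterion. [folklore] -/
theorem exists_prefixed_of_lt_cStarConj {C : ℝ} (hC : 0 < C) (hlt : C < cStarConj) :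
    ∃ m : ℕ, (7 * C / 6) ^ 2 ≤ S m C ((7 * C / 6) ^ 2) := by
  set v₀ := 7 * C / 6 with hv₀def
  have hv₀ : C < v₀ := by rw [hv₀def]; linarith
  have hv₀0 : 0 < v₀ := lt_trans hC hv₀
  set lam := C / (2 * v₀ ^ 3) with hlam
  have hlam0 : 0 ≤ lam := by positivity
  have hgap : 0 < 7 - C ^ 2 * psi (7 / 3) := sub_pos.mpr (sq_mul_psiMin_lt_seven hC hlt)
  obtain ⟨m, hm⟩ := pow_unbounded_of_one_lt (49 * lam / (7 - C ^ 2 * psi (7 / 3))) (by norm_num : (1 : ℝ) < 8)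
  refine ⟨m, ?_⟩
  have h8 : (0 : ℝ) < 8 ^ m := by positivity
  have htau : tau m = 7 / 8 ^ m := rfl
  -- total flow time of the block from `σ₀`
  have key := flowTime_iterate_ge hC hv₀ (tau_pos m).le (8 ^ m)
  rw [Nat.cast_pow, Nat.cast_ofNat] at key
  have hsum : (8 : ℝ) ^ m * (tau m - lam * tau m ^ 2) = 7 - 49 * lam / 8 ^ m := by
    rw [htau]; field_simp; ring
  have hsmall : 49 * lam / 8 ^ m < 7 - C ^ 2 * psi (7 / 3) := by
    rw [div_lt_iff₀ h8]; rw [div_lt_iff₀ hgap] at hm; linarith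
  -- hence the block reaches beyond the doubled `v`
  set xN := (eStep C (tau m))^[8 ^ m] (v₀ ^ 2) with hxN
  have hxN0 : v₀ ^ 2 ≤ xN := le_iterate_eStep hC (tau_pos m).le (pow_le_pow_left₀ hC.le hv₀.le 2) _
  have hsv : Real.sqrt (v₀ ^ 2) = v₀ := Real.sqrt_sq hv₀0.le
  have hT2 : flowTime C (2 * v₀) - flowTime C v₀ = C ^ 2 * psi (7 / 3) := by
    have h := flowTime_halving_at_tangency hC
    rw [← psi_seven_thirds] at h
    have e1 : 7 * C / 3 = 2 * v₀ := by rw [hv₀def]; ring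
    have e2 : 7 * C / 6 = v₀ := by rw [hv₀def]
    rw [e1, e2] at h
    exact h
  have hlt' : flowTime C (2 * v₀) < flowTime C (Real.sqrt xN) := by
    rw [hsv] at key
    rw [hlam] at hsum hsmall
    linarith [key, hsum, hsmall, hT2]
  have hsx : C < Real.sqrt xN := lt_of_lt_of_le hv₀ ((Real.le_sqrt' hv₀0).mpr hxN0)
  have h2v : 2 * v₀ < Real.sqrt xN :=
    ((flowTime_strictMonoOn hC).lt_iff_lt (show C < 2 * v₀ by linarith) hsx).mp hlt'
  -- `4σ₀ ≤ x_N`, i.e. `σ₀ ≤ S_m C σ₀`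
  have h4 : 4 * v₀ ^ 2 ≤ xN := by
    have h0 : (0 : ℝ) ≤ 2 * v₀ := by positivity
    have := pow_le_pow_left₀ h0 h2v.le 2
    rw [Real.sq_sqrt (le_trans (by positivity) hxN0)] at this
    linarith
  show v₀ ^ 2 ≤ S m C (v₀ ^ 2)
  unfold S
  rw [← hxN]
  linarith

/-- **HALF OF THE CONJECTURE: below `cStarConj = √(84∕(77 + 72·log 2))` the octal staircase is IMPOSSIBLE on every box.** [folklore] -/
theorem not_endPossibleLin_bOct_of_lt_cStarConj {C γ₀ : ℝ} (hC : 0 < C) (hlt : C < cStarConj) (hγ₀ : 0 < γ₀) :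
    ¬ EndPossibleLin bOct C γ₀ := by
  obtain ⟨m, hm⟩ := exists_prefixed_of_lt_cStarConj hC hlt
  exact not_endPossibleLin_bOct_of_prefixed hC m (by nlinarith) hm hγ₀

/-- Numeric instance past GEN 11's certified `0.81`: `C = 0.81357` is impossible (`cStarConj > 0.81357`, X16 `cStarConj_gt`). [folklore] -/
theorem not_endPossibleLin_bOct_081357 {γ₀ : ℝ} (hγ₀ : 0 < γ₀) : ¬ EndPossibleLin bOct 0.81357 γ₀ :=
  not_endPossibleLin_bOct_of_lt_cStarConj (by norm_num) cStarConj_gt hγ₀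

/-- **THE BRACKET OF RECORD: `cStarConj ≤ C⋆(bOct) ≤ 9∕10`** — the threshold of GEN 10's `exists_threshold_bOct` lies between the conjectured
constant `√(84∕(77 + 72·log 2)) = 0.81357…` (this file) and `9∕10` (X15 `endPossibleLin_bOct_090`). [folklore] -/
theorem exists_threshold_bOct_conjLower {γ₀ : ℝ} (hγ₀ : 0 < γ₀) :
    ∃ Cstar : ℝ, cStarConj ≤ Cstar ∧ Cstar ≤ 9 / 10 ∧ (∀ C, Cstar < C → EndPossibleLin bOct C γ₀) ∧
      ∀ C, 0 < C → C < Cstar → ¬ EndPossibleLin bOct C γ₀ := by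
  set T : Set ℝ := {C | 0 < C ∧ EndPossibleLin bOct C γ₀} with hT
  have h9 : (9 / 10 : ℝ) ∈ T := ⟨by norm_num, endPossibleLin_bOct_090 hγ₀⟩
  have hlow : ∀ C ∈ T, cStarConj ≤ C := fun C hC =>
    le_of_not_gt fun hlt => not_endPossibleLin_bOct_of_lt_cStarConj hC.1 hlt hγ₀ hC.2
  have hbdd : BddBelow T := ⟨cStarConj, hlow⟩
  refine ⟨sInf T, le_csInf ⟨_, h9⟩ hlow, csInf_le hbdd h9, fun C hC => ?_, fun C hC0 hC hP => ?_⟩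
  · obtain ⟨C', hC'T, hC'C⟩ := exists_lt_of_csInf_lt ⟨_, h9⟩ hC
    exact endPossibleLin_mono hC'C.le hC'T.2
  · exact absurd (csInf_le hbdd ⟨hC0, hP⟩) (not_le.mpr hC)

/-! ## §3 (v1.1, append-only) The crude form of the monotone comparison -/

/-- `C < a ≤ b ⟹ b² − a² ≤ T_C(b) − T_C(a)` (from `flowTime_sub_ge`, since `b∕(b − C) ≥ 1`) — the form in which X19 ∕ X20 use the comparison
(«a time difference bounds a height difference»). [folklore] -/
theorem sq_sub_sq_le_flowTime_sub {C a b : ℝ} (hC : 0 < C) (ha : C < a) (hab : a ≤ b) :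
    b ^ 2 - a ^ 2 ≤ flowTime C b - flowTime C a := by
  have h := flowTime_sub_ge hC ha hab
  have hk : 1 ≤ b / (b - C) := by rw [le_div_iff₀ (by linarith)]; linarith
  have hD : 0 ≤ b ^ 2 - a ^ 2 := by nlinarith
  exact (le_mul_of_one_le_right hD hk).trans h

end

end Summit.QuantumFields.BalabanUV.Gaps.EndDrawdownLinearThresholdLower
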